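import Summits.NavierStokesRegularity.NavierStokesRegularity.Theses.AxisymmetricExtremality
import Literature.Analysis.FluidPDE.AxisymNoSwirlLocalMaxPrinciple
import Literature.Analysis.FluidPDE.SingularKernelGradient
import HarnessLib

/-!
# Seregin 2020, proof of Thm 2.1, the no-swirl endgame core: the cut-off field `W = χ • V` of
# the `η = ω_θ/ϱ` maximum principle

Helper toward the stub `stub_seregin2020TypeII` of the crux `AxisymmetricKatoGlobal` (= the named
fact `Literature.Analysis.FluidPDE.Seregin2020_axisymmetricSingularPoint_typeII`, G. Seregin,
Anal. Math. Phys. 10 (2020) Paper 46 = arXiv:2006.04140, Thm 2.1), last paragraph of the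
printed proof (arXiv p. 8: "by considering a problem for `η = ω_φ/ϱ` … reduction of it to
spatial dimension 5"). The tree's local maximum principle for `η`
(`Literature.Analysis.FluidPDE.noSwirl_abs_scalar_le_of_boundary`) is stated for a GLOBALLY
smooth, axisymmetric, swirl-free family `W τ`, `τ ∈ I`, with uniform-in-`x` time moduli of all
`x`-derivatives (`hunif`) — "in applications `W = χ V` for a smooth representative `V` of the
solution near a regular region and an axisymmetric cut-off `χ`" (its module docstring). This
file builds that cut-off field for a family `V τ` whose slices are smooth at the points of a
ball `B(c, 3ρ)` about an axis point `c`, with the radial cut-off `χ = suppCutoff c ρ` (`= 1` on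
`B̄(c, ρ)`, `= 0` off `B(c, 2ρ)`):

* `cutoffField_contDiff`, `cutoffField_isAxisymmetric`, `cutoffField_hasNoSwirl` — `W τ` is
  globally smooth, axisymmetric (for `c` on the axis), swirl free;
* `cutoffField_eventuallyEq`, `cutoffField_local` — `W τ` agrees with `V τ` near every point of
  `B(c, ρ)`, so all local quantities (value, derivative, curl, its derivative and Laplacian)
  agree there;
* `unifTime_cutoffField` — the uniform-in-`x` time moduli of all `x`-derivatives of `W` on an
  open time set `I` from the joint continuity of the `D_xⁿ V` on `I × B(c, 3ρ)` (uniform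
  continuity on `[τ - δ, τ + δ] × B̄(c, 2ρ)` and the Leibniz bound
  `norm_iteratedFDerivWithin_smul_le`).

## References

* G. Seregin, Anal. Math. Phys. 10 (2020), Paper 46 = arXiv:2006.04140, proof of Thm. 2.1, last
  paragraph (arXiv p. 8). [Seregin2020]
* G. Koch, N. Nadirashvili, G. Seregin, V. Šverák, Acta Math. 203 (2009) 83–105, §5 p. 9 (the
  lifted equation is applied to a localised smooth field). [KochNadirashviliSereginSverak2009]
-/

-- the problem directory repeats the summit name (D-0017); core's `dupNamespace` linter fires
set_option linter.dupNamespace false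

noncomputable section

open MeasureTheory Set Function Filter Topology TopologicalSpace Metric
open scoped NNReal ENNReal ContDiff Laplacian

namespace Summit.NavierStokesRegularity.NavierStokesRegularity.Theorems.AxisymmetricKatoGlobal.EulerScaling

open Literature.Analysis.FluidPDE

/-! ### The cut-off field `W τ = χ • V τ` -/

section Cutoff

variable {V : ℝ → EuclideanSpace ℝ (Fin 3) → EuclideanSpace ℝ (Fin 3)}
  {c : EuclideanSpace ℝ (Fin 3)} {ρ : ℝ}

/-- The radial cut-off about an axis point is rotation invariant. [folklore] -/
theorem suppCutoff_rotZ (hc : c 0 = 0 ∧ c 1 = 0) (ρ θ : ℝ) (y : EuclideanSpace ℝ (Fin 3)) :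
    suppCutoff c ρ (rotZ θ y) = suppCutoff c ρ y := by
  have h1 : rotZ θ c = c := by
    ext i
    fin_cases i <;> simp [hc.1, hc.2]
  have h2 : rotZ θ y - c = rotZ θ (y - c) := by
    rw [← rotZL_apply, ← rotZL_apply, map_sub, rotZL_apply θ c, h1]
  unfold suppCutoff
  rw [h2]
  exact radialCutoff_radial _ _ (norm_rotZ θ _)

/-- Off `B(c, 2ρ)` the cut-off field vanishes near the point. [folklore] -/
theorem cutoffField_eventuallyEq_zero (hρ : 0 < ρ) (τ : ℝ) {y : EuclideanSpace ℝ (Fin 3)}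
    (hy : 2 * ρ < dist y c) :
    (fun y => suppCutoff c ρ y • V τ y) =ᶠ[𝓝 y] fun _ => 0 := by
  have hopen : IsOpen {z : EuclideanSpace ℝ (Fin 3) | 2 * ρ < dist z c} :=
    isOpen_lt continuous_const (continuous_id.dist continuous_const)
  filter_upwards [hopen.mem_nhds hy] with z hz
  rw [suppCutoff_eq_zero hρ (by rw [← dist_eq_norm]; exact le_of_lt hz), zero_smul]

/-- On `B(c, ρ)` the cut-off field is the field, near the point. [folklore] -/
theorem cutoffField_eventuallyEq (hρ : 0 < ρ) (τ : ℝ) {x : EuclideanSpace ℝ (Fin 3)}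
    (hx : x ∈ ball c ρ) : (fun y => suppCutoff c ρ y • V τ y) =ᶠ[𝓝 x] V τ := by
  filter_upwards [isOpen_ball.mem_nhds hx] with z hz
  rw [suppCutoff_eq_one hρ (by rw [← dist_eq_norm]; exact (mem_ball.1 hz).le), one_smul]

/-- **The cut-off field is globally smooth** when the slices are smooth at the points of
`B(c, 3ρ)`. [folklore] -/
theorem cutoffField_contDiff (hρ : 0 < ρ) {τ : ℝ}
    (hV : ∀ y ∈ ball c (3 * ρ), ContDiffAt ℝ ∞ (V τ) y) :
    ContDiff ℝ ∞ fun y => suppCutoff c ρ y • V τ y := by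
  refine contDiff_iff_contDiffAt.2 fun y => ?_
  by_cases hy : dist y c < 3 * ρ
  · exact (contDiff_suppCutoff c ρ).contDiffAt.smul (hV y (mem_ball.2 hy))
  · have h2 : 2 * ρ < dist y c := by linarith [not_lt.1 hy]
    exact (contDiffAt_const (c := (0 : EuclideanSpace ℝ (Fin 3)))).congr_of_eventuallyEq
      (cutoffField_eventuallyEq_zero hρ τ h2)

/-- **The cut-off field is axisymmetric** when the field is axisymmetric at the points of
`B(c, 3ρ)` and `c` is on the axis. [folklore] -/
theorem cutoffField_isAxisymmetric (hc : c 0 = 0 ∧ c 1 = 0) (hρ : 0 < ρ) {τ : ℝ}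
    (hV : ∀ θ : ℝ, ∀ y ∈ ball c (3 * ρ), V τ (rotZ θ y) = rotZ θ (V τ y)) :
    IsAxisymmetric fun y => suppCutoff c ρ y • V τ y := by
  intro θ y
  simp only
  rw [suppCutoff_rotZ hc]
  by_cases hy : dist y c < 3 * ρ
  · rw [hV θ y (mem_ball.2 hy), ← rotZL_apply, ← rotZL_apply, map_smul]
  · have h2 : 2 * ρ ≤ ‖y - c‖ := by rw [← dist_eq_norm]; linarith [not_lt.1 hy]
    rw [suppCutoff_eq_zero hρ h2, zero_smul, zero_smul, ← rotZL_apply, map_zero]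

/-- **The cut-off field is swirl free** when the field is swirl free at the points of
`B(c, 3ρ)`. [folklore] -/
theorem cutoffField_hasNoSwirl (hρ : 0 < ρ) {τ : ℝ}
    (hV : ∀ y ∈ ball c (3 * ρ), swirl (V τ) y = 0) :
    HasNoSwirl fun y => suppCutoff c ρ y • V τ y := by
  intro y
  have e : swirl (fun y => suppCutoff c ρ y • V τ y) y = suppCutoff c ρ y * swirl (V τ) y := by
    simp only [swirl, PiLp.smul_apply, smul_eq_mul]
    ring
  rw [e]
  by_cases hy : dist y c < 3 * ρ
  · rw [hV y (mem_ball.2 hy), mul_zero]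
  · have h2 : 2 * ρ ≤ ‖y - c‖ := by rw [← dist_eq_norm]; linarith [not_lt.1 hy]
    rw [suppCutoff_eq_zero hρ h2, zero_mul]

/-- Local quantities of the cut-off field on `B(c, ρ)` are those of the field: the value, the
derivative, the curl, the derivative and the Laplacian of the curl, and the derivative of the
`e₁`-component of the curl. [folklore] -/
theorem cutoffField_local (hρ : 0 < ρ) (τ : ℝ) {x : EuclideanSpace ℝ (Fin 3)}
    (hx : x ∈ ball c ρ) :
    (fun y => suppCutoff c ρ y • V τ y) x = V τ x ∧
    fderiv ℝ (fun y => suppCutoff c ρ y • V τ y) x = fderiv ℝ (V τ) x ∧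
    curl (fun y => suppCutoff c ρ y • V τ y) x = curl (V τ) x ∧
    fderiv ℝ (curl fun y => suppCutoff c ρ y • V τ y) x = fderiv ℝ (curl (V τ)) x ∧
    (Δ (curl fun y => suppCutoff c ρ y • V τ y)) x = (Δ (curl (V τ))) x ∧
    fderiv ℝ (fun z => curl (fun y => suppCutoff c ρ y • V τ y) z 1) x =
      fderiv ℝ (fun z => curl (V τ) z 1) x := by
  have hev := cutoffField_eventuallyEq (V := V) hρ τ hx
  -- the curls agree near `x`
  have hcurl : curl (fun y => suppCutoff c ρ y • V τ y) =ᶠ[𝓝 x] curl (V τ) := by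
    filter_upwards [hev.eventually_nhds] with z hz
    have hz' : (fun y => suppCutoff c ρ y • V τ y) =ᶠ[𝓝 z] V τ := hz
    rw [curl_eq_curlCLM, curl_eq_curlCLM, hz'.fderiv_eq]
  have hcurl1 : (fun z => curl (fun y => suppCutoff c ρ y • V τ y) z 1) =ᶠ[𝓝 x]
      fun z => curl (V τ) z 1 := by
    filter_upwards [hcurl] with z hz
    rw [hz]
  refine ⟨hev.self_of_nhds, hev.fderiv_eq, hcurl.self_of_nhds, hcurl.fderiv_eq,
    (InnerProductSpace.laplacian_congr_nhds hcurl).self_of_nhds, hcurl1.fderiv_eq⟩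

/-! ### Uniform-in-`x` time moduli of the `x`-derivatives of the cut-off field -/

/-- **Uniform continuity of finitely many spatial Taylor coefficients on a compact set** (from
their joint continuity). [folklore] -/
theorem exists_forall_norm_iteratedFDeriv_sub_le {I : Set ℝ} {U : Set (EuclideanSpace ℝ (Fin 3))}
    {K : Set (ℝ × EuclideanSpace ℝ (Fin 3))} (hK : IsCompact K) (hKsub : K ⊆ I ×ˢ U)
    (hVc : ∀ n : ℕ, ContinuousOn
      (fun w : ℝ × EuclideanSpace ℝ (Fin 3) => iteratedFDeriv ℝ n (V w.1) w.2) (I ×ˢ U))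
    (m : ℕ) {η : ℝ} (hη : 0 < η) :
    ∃ δ > 0, ∀ j ≤ m, ∀ a ∈ K, ∀ b ∈ K, dist a b < δ →
      ‖iteratedFDeriv ℝ j (V a.1) a.2 - iteratedFDeriv ℝ j (V b.1) b.2‖ ≤ η := by
  induction m with
  | zero =>
    obtain ⟨δ, hδ, h⟩ := Metric.uniformContinuousOn_iff.1
      (hK.uniformContinuousOn_of_continuous ((hVc 0).mono hKsub)) η hη
    refine ⟨δ, hδ, fun j hj a ha b hb hab => ?_⟩
    obtain rfl : j = 0 := Nat.le_zero.1 hj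
    rw [← dist_eq_norm]
    exact (h a ha b hb hab).le
  | succ m ih =>
    obtain ⟨δ₁, hδ₁, h₁⟩ := ih
    obtain ⟨δ₂, hδ₂, h₂⟩ := Metric.uniformContinuousOn_iff.1
      (hK.uniformContinuousOn_of_continuous ((hVc (m + 1)).mono hKsub)) η hη
    refine ⟨min δ₁ δ₂, lt_min hδ₁ hδ₂, fun j hj a ha b hb hab => ?_⟩
    rcases Nat.of_le_succ hj with hj' | rfl
    · exact h₁ j hj' a ha b hb (hab.trans_le (min_le_left _ _))
    · rw [← dist_eq_norm]
      exact (h₂ a ha b hb (hab.trans_le (min_le_right _ _))).le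

/-- A uniform bound for the derivatives of order `≤ k` of the cut-off. [folklore] -/
theorem exists_forall_norm_iteratedFDeriv_suppCutoff_le (c : EuclideanSpace ℝ (Fin 3)) (hρ : 0 < ρ)
    (k : ℕ) : ∃ C : ℝ, 0 ≤ C ∧ ∀ i ≤ k, ∀ y, ‖iteratedFDeriv ℝ i (suppCutoff c ρ) y‖ ≤ C := by
  have hχ : ContDiff ℝ ∞ (suppCutoff c ρ) := contDiff_suppCutoff c ρ
  have hχc : HasCompactSupport (suppCutoff c ρ) := hasCompactSupport_suppCutoff c hρ
  have hone : ∀ i : ℕ, ∃ C : ℝ, ∀ y, ‖iteratedFDeriv ℝ i (suppCutoff c ρ) y‖ ≤ C := fun i =>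
    (hχ.continuous_iteratedFDeriv (by exact_mod_cast le_top)).bounded_above_of_compact_support
      (hχc.iteratedFDeriv i)
  induction k with
  | zero =>
    obtain ⟨C, hC⟩ := hone 0
    refine ⟨max C 0, le_max_right _ _, fun i hi y => ?_⟩
    obtain rfl : i = 0 := Nat.le_zero.1 hi
    exact (hC y).trans (le_max_left _ _)
  | succ k ih =>
    obtain ⟨C₁, hC₁0, hC₁⟩ := ih
    obtain ⟨C₂, hC₂⟩ := hone (k + 1)
    refine ⟨max C₁ C₂, le_max_of_le_left hC₁0, fun i hi y => ?_⟩
    rcases Nat.of_le_succ hi with hi' | rfl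
    · exact (hC₁ i hi' y).trans (le_max_left _ _)
    · exact (hC₂ y).trans (le_max_right _ _)

/-- **The uniform-in-`x` time moduli of all `x`-derivatives of the cut-off field** (hypothesis
`hunif` of the maximum principle): on an open time set `I`, if the slices `V τ`, `τ ∈ I`, are
smooth at the points of `B(c, 3ρ)` and all `D_xⁿ V` are jointly continuous on `I × B(c, 3ρ)`,
then for `W τ = χ • V τ`, every `k`, `τ ∈ I` and `ε > 0` there is `δ > 0` with
`‖D_xᵏ W(τ', y) - D_xᵏ W(τ, y)‖ ≤ ε` for all `τ' ∈ I`, `|τ' - τ| < δ` and ALL `y`: off `B̄(c, 2ρ)`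
both terms vanish; on it, the Leibniz bound (`norm_iteratedFDerivWithin_smul_le`) and the
uniform continuity of `D_xʲ V`, `j ≤ k`, on the compact `[τ - δ₀, τ + δ₀] × B̄(c, 2ρ)`.
[folklore] -/
theorem unifTime_cutoffField :
    ∀ (V : ℝ → EuclideanSpace ℝ (Fin 3) → EuclideanSpace ℝ (Fin 3)) (c : EuclideanSpace ℝ (Fin 3))
      (ρ : ℝ) (I : Set ℝ), IsOpen I → 0 < ρ →
      (∀ τ ∈ I, ∀ y ∈ ball c (3 * ρ), ContDiffAt ℝ (⊤ : ℕ∞) (V τ) y) →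
      (∀ n : ℕ, ContinuousOn
        (fun w : ℝ × EuclideanSpace ℝ (Fin 3) => iteratedFDeriv ℝ n (V w.1) w.2)
        (I ×ˢ ball c (3 * ρ))) →
      ∀ k : ℕ, ∀ τ ∈ I, ∀ ε > 0, ∃ δ > 0, ∀ τ' ∈ I, |τ' - τ| < δ → ∀ y,
        ‖iteratedFDeriv ℝ k (fun y => suppCutoff c ρ y • V τ' y) y -
          iteratedFDeriv ℝ k (fun y => suppCutoff c ρ y • V τ y) y‖ ≤ ε := by
  intro V c ρ I hI hρ hVs hVc k τ hτ ε hε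
  have hU : IsOpen (ball c (3 * ρ)) := isOpen_ball
  have hcast : ∀ m : ℕ, ((m : ℕ∞) : WithTop ℕ∞) ≤ ((⊤ : ℕ∞) : WithTop ℕ∞) := fun m => by
    exact_mod_cast le_top
  -- bounds for the cut-off
  obtain ⟨Cχ, hCχ0, hCχ⟩ := exists_forall_norm_iteratedFDeriv_suppCutoff_le c hρ k
  -- a compact time window inside `I`
  obtain ⟨δ₀, hδ₀, hwin⟩ : ∃ δ₀ > 0, Icc (τ - δ₀) (τ + δ₀) ⊆ I := by
    obtain ⟨r, hr, hrI⟩ := Metric.isOpen_iff.1 hI τ hτ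
    refine ⟨r / 2, half_pos hr, fun s hs => hrI ?_⟩
    rw [mem_ball, Real.dist_eq, abs_lt]
    constructor <;> linarith [hs.1, hs.2]
  set K : Set (ℝ × EuclideanSpace ℝ (Fin 3)) := Icc (τ - δ₀) (τ + δ₀) ×ˢ closedBall c (2 * ρ)
    with hK
  have hKc : IsCompact K := isCompact_Icc.prod (isCompact_closedBall _ _)
  have hKsub : K ⊆ I ×ˢ ball c (3 * ρ) :=
    prod_mono hwin (closedBall_subset_ball (by linarith))
  -- the modulus of the `D_xʲ V`, `j ≤ k`, on `K`
  have hη : 0 < ε / (2 ^ k * Cχ + 1) := by positivity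
  obtain ⟨δ₁, hδ₁, hmod⟩ := exists_forall_norm_iteratedFDeriv_sub_le hKc hKsub hVc k hη
  refine ⟨min δ₀ δ₁, lt_min hδ₀ hδ₁, fun τ' hτ' hlt y => ?_⟩
  have hlt₀ : |τ' - τ| < δ₀ := hlt.trans_le (min_le_left _ _)
  have hlt₁ : |τ' - τ| < δ₁ := hlt.trans_le (min_le_right _ _)
  by_cases hy : dist y c ≤ 2 * ρ
  · -- ## on `B̄(c, 2ρ)`: Leibniz
    have hyU : y ∈ ball c (3 * ρ) := mem_ball.2 (by linarith)
    have hτ'w : τ' ∈ Icc (τ - δ₀) (τ + δ₀) := by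
      rw [abs_lt] at hlt₀; exact ⟨by linarith, by linarith⟩
    have hτw : τ ∈ Icc (τ - δ₀) (τ + δ₀) := ⟨by linarith, by linarith⟩
    have ha : ((τ', y) : ℝ × EuclideanSpace ℝ (Fin 3)) ∈ K := ⟨hτ'w, mem_closedBall.2 hy⟩
    have hb : ((τ, y) : ℝ × EuclideanSpace ℝ (Fin 3)) ∈ K := ⟨hτw, mem_closedBall.2 hy⟩
    have hab : dist ((τ', y) : ℝ × EuclideanSpace ℝ (Fin 3)) (τ, y) < δ₁ := by
      rw [Prod.dist_eq, dist_self, Real.dist_eq]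
      exact max_lt hlt₁ (by simpa using hδ₁)
    -- the difference field
    set D : EuclideanSpace ℝ (Fin 3) → EuclideanSpace ℝ (Fin 3) := V τ' - V τ with hD
    have hDs : ContDiffOn ℝ k D (ball c (3 * ρ)) := fun z hz =>
      (((hVs τ' hτ' z hz).sub (hVs τ hτ z hz)).of_le (hcast k)).contDiffWithinAt
    have hχs : ContDiffOn ℝ k (suppCutoff c ρ) (ball c (3 * ρ)) :=
      (contDiff_suppCutoff c ρ (n := (k : ℕ∞))).contDiffOn
    have hdiff : (fun y => suppCutoff c ρ y • V τ' y) - (fun y => suppCutoff c ρ y • V τ y) =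
        fun y => suppCutoff c ρ y • D y := by
      funext z
      simp only [Pi.sub_apply, hD, smul_sub]
    have hWτ' : ContDiff ℝ ∞ fun y => suppCutoff c ρ y • V τ' y :=
      cutoffField_contDiff hρ (hVs τ' hτ')
    have hWτ : ContDiff ℝ ∞ fun y => suppCutoff c ρ y • V τ y :=
      cutoffField_contDiff hρ (hVs τ hτ)
    rw [← iteratedFDeriv_sub_apply (hWτ'.of_le (hcast k)).contDiffAt
      (hWτ.of_le (hcast k)).contDiffAt, hdiff,
      ← iteratedFDerivWithin_of_isOpen k hU hyU]
    have hleib := norm_iteratedFDerivWithin_smul_le (𝕜 := ℝ) hχs hDs hU.uniqueDiffOn hyU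
      (n := k) le_rfl
    refine hleib.trans ?_
    -- each term is at most `C(k, i) Cχ η`
    have hterm : ∀ i ∈ Finset.range (k + 1),
        (k.choose i : ℝ) * ‖iteratedFDerivWithin ℝ i (suppCutoff c ρ) (ball c (3 * ρ)) y‖ *
          ‖iteratedFDerivWithin ℝ (k - i) D (ball c (3 * ρ)) y‖ ≤
        (k.choose i : ℝ) * Cχ * (ε / (2 ^ k * Cχ + 1)) := by
      intro i hi
      have hik : i ≤ k := Nat.lt_succ_iff.1 (Finset.mem_range.1 hi)
      rw [iteratedFDerivWithin_of_isOpen i hU hyU, iteratedFDerivWithin_of_isOpen (k - i) hU hyU]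
      have h1 : ‖iteratedFDeriv ℝ (k - i) D y‖ ≤ ε / (2 ^ k * Cχ + 1) := by
        rw [hD, iteratedFDeriv_sub_apply ((hVs τ' hτ' y hyU).of_le (hcast (k - i)))
          ((hVs τ hτ y hyU).of_le (hcast (k - i)))]
        exact hmod (k - i) (Nat.sub_le k i) (τ', y) ha (τ, y) hb hab
      have h2 := hCχ i hik y
      have h3 : (0 : ℝ) ≤ k.choose i := Nat.cast_nonneg _
      exact mul_le_mul (mul_le_mul_of_nonneg_left h2 h3) h1 (norm_nonneg _) (by positivity)
    refine (Finset.sum_le_sum hterm).trans ?_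
    rw [← Finset.sum_mul, ← Finset.sum_mul]
    have hsum : ∑ i ∈ Finset.range (k + 1), (k.choose i : ℝ) = 2 ^ k := by
      rw [← Nat.cast_sum, Nat.sum_range_choose]; norm_num
    rw [hsum]
    have hA : 0 ≤ (2 : ℝ) ^ k * Cχ := mul_nonneg (pow_nonneg zero_le_two k) hCχ0
    calc (2 : ℝ) ^ k * Cχ * (ε / (2 ^ k * Cχ + 1)) = ε * (2 ^ k * Cχ / (2 ^ k * Cχ + 1)) := by ring
      _ ≤ ε * 1 := by
          refine mul_le_mul_of_nonneg_left ?_ hε.le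
          rw [div_le_one (by positivity)]
          linarith
      _ = ε := mul_one ε
  · -- ## off `B̄(c, 2ρ)`: both terms vanish
    have h2 : 2 * ρ < dist y c := not_le.1 hy
    have hz : ∀ σ : ℝ, iteratedFDeriv ℝ k (fun y => suppCutoff c ρ y • V σ y) y = 0 := fun σ => by
      rw [((cutoffField_eventuallyEq_zero (V := V) hρ σ h2).iteratedFDeriv ℝ k).eq_of_nhds,
        iteratedFDeriv_fun_zero]
      rfl
    rw [hz τ', hz τ, sub_zero, norm_zero]
    exact hε.le

end Cutoff

end Summit.NavierStokesRegularity.NavierStokesRegularity.Theorems.AxisymmetricKatoGlobal.EulerScaling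

end
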